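/-
Copyright (c) 2026 the pub-hodgecm-mathlib formalisation cell (harness21).  R90-TF SLAB, section S10 (Rogawski 1990, Ch. 13.8), prover R90-C138-p01 (g0):
DEAL #32 (dealer R90-C138-plan (g3), 2026-09-05T01:57:39Z) — the ALL-PLACES JUNCTION (J) of the abstract letter (3′) and the (M3) ASSEMBLY over it;
h413 = `stmt-HodgeConjecture-24833`, route `HCCMUnconditional`.
-/
import Summits.HodgeConjecture.HodgeConjecture.Theorems.R90S10PSLocalCharTransferAbstractSplit    -- ★ p864269 (p06): (3′) at a SPLIT place `localCharTransferAbstract_of_split`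
import Summits.HodgeConjecture.HodgeConjecture.Theorems.R90S10PSLocalCharTransfer                 -- ★ (p05): (3) at a NON-SPLIT place `localCharTransfer_cmPrincipalSeries_of_canonical`
import Summits.HodgeConjecture.HodgeConjecture.Theorems.R90S10PSLocalCharTransferAbstractLetters  -- ★ p864224: (3′) `PSLocalCharTransferAbstractLetter`, `…_of_letter`, bridge′
import Literature.NumberTheory.Automorphic.LocalUnitaryIntegralLevel                              -- ★ `isCompact_isOpen_cmLocalIntegralLevel`
import HarnessLib

/-!
# R90-TF ∕ S10 — THE (3′) JUNCTION AT EVERY FINITE PLACE AND THE (M3) ASSEMBLY FROM THE LETTERS: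
# `psLocalCharTransferAbstractLetter_of_letters`, `exists_unramCharIdentityLetter_of_letters`, `unramCharIdentityLetter_of_letters`

Cell hodgecm-mathlib, slab R90-TF, section S10 = [Rogawski1990] §13.8 (p. 219 L3), crux item h413 = `stmt-HodgeConjecture-24833`; kernel lane
`--kind proof --supports stmt-HodgeConjecture-24833 --as helper`; THEOREMS ONLY (no `def`, no instance, no notation, no `sorry`); never imports `Cruxes/…/Lines`.

THE JUNCTION (J).  At a finite place `w` of `L⁺`, for right-invariant Haar measures `νQw, νHw`, Borel quotient σ-algebras, CANONICAL orbital families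
`(mHw, mQw)` (`hmH`, `hmQ`) and `μ|_{𝕀_{L⁺}} = ω_{L∕L⁺}` (`hμω`), the abstract letter (3′) ★ `PSLocalCharTransferAbstractLetter L μ w KG KHw νQw νHw mHw mQw`
(RULING J-M3-5: an ADMISSIBLE partner `I` of `ρ_w ≅ i_H(χ₂ ⊠ χ₁)` with a `K`-line and `Tr I(φ) = Tr ρ_w(f^H)` on matched pairs) follows from THREE LETTERS:
* (M-a) ★ `SplitHVanDijkLetter L μ w νHw mHw mQw` and (M-b′) ★ `SplitAbstractTransferLetter L μ w νQw νHw` — used only when `w` SPLITS in `L`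
  (★ p864269 `localCharTransferAbstract_of_split`, [Rogawski1990, §4.13 Lemma 4.13.1; vanDijk1972]);
* `hFL` — the UNIT IDENTITY at `w` ★ `IsLocalUnitTransfer L (qsForm L) w Δ‴_w mHw mQw` ([Rogawski1990, §4.9 Prop. 4.9.1 (b) p. 55], the unit fundamental lemma)
  BEHIND the guards the letter (3′) itself supplies — ⟪U⟫ at `w`, `w` NON-SPLIT, unit masses `νHw(K_H) = νQw(K) = 1` — i.e. the body tokens of ★
  `UnitFLDyadicUnrLetter L μ v` at `w` (★ `Theorems/R90S10UnitFLDyadicUnrLetterDefs`) minus its dyadicity clause, so that a consumer pays it by the EXT socket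
  `stub_R90_ext_unitFL₂` at dyadic inert `w` and by ★ `isLocalUnitTransfer_of_nonsplit_of_isUnit_two` off `2`; used only when `w` is NON-SPLIT, through ★ (p05)
  `localCharTransfer_cmPrincipalSeries_of_canonical` (letter (3) with the model `I = i_G(χ̃)`) and ★ `psLocalCharTransferAbstractLetter_of_letter` ((3) ⇒ (3′)).
No `v` ∕ `w ≠ v` binder: (J) is local at `w`; a consumer instantiates its `∀ w ≠ v`-families at `w`.

THE (M3) ASSEMBLY.  ★ bridge′ `exists_unramCharIdentityLetter_of_abstractLetter` ∕ `unramCharIdentityLetter_of_abstractLetter` (★ p864224) composed with (J): the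
hypothesis `hβ : PSLocalCharTransferAbstractLetter …` is REPLACED by `(hA) (hB') (hFL) (hμω) (hmH) (hmQ)`, and the three binders `hKo hKc hμK` are DISCHARGED in-file from
the level pin `hKG` (★ `isCompact_isOpen_cmLocalIntegralLevel`) and the unit volume `hvolG`; the remaining binders are ★ p864224's, verbatim.

HONEST LABEL: (3′) ∕ (M3) at `w` are paid only modulo the letters `hA hB'` (split `w`) and `hFL` (non-split `w`: the unit fundamental lemma — EXT at dyadic inert `w`);
HC_CM is proved only modulo the 7 printed citations (2 remaining named inputs: hLiu418 = `stmt-HodgeConjecture-24832`, h413 = `stmt-HodgeConjecture-24833`) until rung 0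
closes; REL ≠ ★ ≠ BUILT.

## References
* [Rogawski1990] J. Rogawski, *Automorphic Representations of Unitary Groups in Three Variables*, Ann. of Math. Stud. 123 (1990), §4.9 Prop. 4.9.1 (b) p. 55,
  Lemma 4.9.2 pp. 55–56; §4.13 Lemma 4.13.1 pp. 64–66; §12.1 p. 171; §13.1 p. 199 ¶3; §13.6 p. 209; §13.8 p. 217, p. 218 L9 (ii), p. 219 L3.
* [vanDijk1972] G. van Dijk, *Computation of certain induced characters of 𝔭-adic groups*, Math. Ann. 199 (1972), Thm. p. 237.
* [BlasiusRogawski1992] D. Blasius, J. Rogawski, *Fundamental lemmas for U(3) and related groups*, in: The zeta functions of Picard modular surfaces (1992), Thm. 1.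
* [CartierCorvallis1979] P. Cartier, *Representations of 𝔭-adic groups: a survey*, Proc. Sympos. Pure Math. 33.1 (1979), §IV.1 Cor. 4.1–4.2.
-/

set_option autoImplicit false
set_option linter.dupNamespace false

noncomputable section

open scoped Matrix MatrixGroups
open MeasureTheory NumberField IsDedekindDomain
open Literature.NumberTheory.Rogawski1990 Literature.NumberTheory.Automorphic Literature.NumberTheory.Automorphic.UnitaryGroup
open Literature.NumberTheory.GaloisRepresentations
open Summit.HodgeConjecture.HodgeConjecture.Cruxes.H413.K2E1TraceFormulaBeta

namespace Summit.HodgeConjecture.HodgeConjecture.R90.S10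

section Junction

variable (L : Type) [Field L] [NumberField L] [IsCMField L] (μ : HeckeCharacter L) (w : Pl L)
  [MeasurableSpace (HLoc L w)] [BorelSpace (HLoc L w)] [MeasurableSpace (Gqs L w)] [BorelSpace (Gqs L w)]
  [∀ a : HLoc L w, MeasurableSpace (HLoc L w ⧸ Subgroup.centralizer ({a} : Set (HLoc L w)))]
  [∀ a : HLoc L w, BorelSpace (HLoc L w ⧸ Subgroup.centralizer ({a} : Set (HLoc L w)))]
  [∀ γ : Gqs L w, MeasurableSpace (Gqs L w ⧸ Subgroup.centralizer ({γ} : Set (Gqs L w)))]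
  [∀ γ : Gqs L w, BorelSpace (Gqs L w ⧸ Subgroup.centralizer ({γ} : Set (Gqs L w)))]
  (KG : Subgroup (Gqs L w)) (KHw : Subgroup (HLoc L w)) (νQw : Measure (Gqs L w)) (νHw : Measure (HLoc L w))
  [νQw.IsHaarMeasure] [νHw.IsHaarMeasure] [νQw.IsMulRightInvariant] [νHw.IsMulRightInvariant]
  (mHw : OrbitalMeasureFamily (HLoc L w)) (mQw : OrbitalMeasureFamily (Gqs L w))

/-- **(J) THE JUNCTION — letter (3′) at EVERY finite place from the letters (M-a), (M-b′) and the guarded unit identity `hFL`.**  Split `w`: ★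
`localCharTransferAbstract_of_split` (van Dijk + the named split transfer).  Non-split `w`: the letter's own guards (⟪U⟫, level pins, unit volumes) feed `hFL`, ★
`localCharTransfer_cmPrincipalSeries_of_canonical` gives letter (3) and ★ `psLocalCharTransferAbstractLetter_of_letter` forgets the model.
[cite: Rogawski1990, §4.9 Lemma 4.9.2 pp. 55–56, Prop. 4.9.1 (b) p. 55; §4.13 Lemma 4.13.1 pp. 64–66; §13.8 p. 219 L3] [cite: vanDijk1972, Thm. p. 237] -/
theorem psLocalCharTransferAbstractLetter_of_letters
    (hA : SplitHVanDijkLetter L μ w νHw mHw mQw) (hB' : SplitAbstractTransferLetter L μ w νQw νHw)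
    (hFL : (∀ W : PlacesOver L w, Algebra.IsUnramifiedAt (𝓞 ↥(maximalRealSubfield L)) W.1.asIdeal ∧ μ.IsUnramifiedAt W.1) →
      (∀ W : PlacesOver L w, IsCMField.complexConj L • W.1 = W.1) →
      νHw (((cmLocalIntegralLevel L 2 (Matrix.of fun i j : Fin 2 => if i.val + j.val + 1 = 2 then (1 : L) else 0) w).prod
            (cmLocalIntegralLevel L 1 (Matrix.of fun i j : Fin 1 => if i.val + j.val + 1 = 1 then (1 : L) else 0) w) :
          Subgroup (HLoc L w)) : Set (HLoc L w)) = 1 →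
      νQw (cmLocalIntegralLevel L 3 (qsForm L) w : Set (Gqs L w)) = 1 →
      IsLocalUnitTransfer L (qsForm L) w ((finExplicitCollection L (qsForm L) μ (finExplicitDelta_conj_left_all L (qsForm L) μ)
        (finExplicitDelta_conj_right_all L (qsForm L) μ)) w) mHw mQw)
    (hμω : ∀ x : Literature.NumberTheory.GaloisRepresentations.ideleGroup ↥(maximalRealSubfield L),
      μ (AdeleRing.ideleBaseChange (↥(maximalRealSubfield L)) L x) = quadraticHeckeCharCM L x)
    (hmH : mHw.IsCanonical (IsLocalGRegular L w) νHw)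
    (hmQ : mQw.IsCanonical (fun γ => IsRegularElt (γ.val : GL (Fin 3) (UnitaryGroup.LocalRing L w))) νQw) :
    PSLocalCharTransferAbstractLetter L μ w KG KHw νQw νHw mHw mQw := by
  by_cases hs : ∃ W : PlacesOver L w, IsCMField.complexConj L • W.1 ≠ W.1
  · exact localCharTransferAbstract_of_split L μ w KG KHw νQw νHw mHw mQw hA hB' hs hμω ⟨hmH, hmQ⟩
  · push Not at hs
    intro hU hKG hKH hvolH hvolG
    subst hKG hKH
    exact psLocalCharTransferAbstractLetter_of_letter L μ w _ _ νQw νHw mHw mQw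
      (localCharTransfer_cmPrincipalSeries_of_canonical L μ w _ _ νQw νHw mHw mQw hμω hmH hmQ hs (hFL hU hs hvolH hvolG)) hU rfl rfl hvolH hvolG

/-- **(M3) ASSEMBLY, ∃-FORM — from the letters**: at an unramified place (⟪U⟫, level pins, unit volumes), every `ρ_w ≅ i_H(χ₂ ⊠ χ₁)` (`χ₁` smooth) with a `K_H`-line has an
ADMISSIBLE `K_w`-spherical class `π_w` with `UnramCharIdentityLetter … π_w ρ_w` — ★ bridge′ `exists_unramCharIdentityLetter_of_abstractLetter` over (J); `K` compact open
(★ `isCompact_isOpen_cmLocalIntegralLevel`) from the level pin. [cite: Rogawski1990, §13.8 p. 219 L3; §4.9 Lemma 4.9.2 pp. 55–56; §13.1 p. 199 ¶3]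
[cite: CartierCorvallis1979, §IV.1 Cor. 4.1–4.2] -/
theorem exists_unramCharIdentityLetter_of_letters
    (hA : SplitHVanDijkLetter L μ w νHw mHw mQw) (hB' : SplitAbstractTransferLetter L μ w νQw νHw)
    (hFL : (∀ W : PlacesOver L w, Algebra.IsUnramifiedAt (𝓞 ↥(maximalRealSubfield L)) W.1.asIdeal ∧ μ.IsUnramifiedAt W.1) →
      (∀ W : PlacesOver L w, IsCMField.complexConj L • W.1 = W.1) →
      νHw (((cmLocalIntegralLevel L 2 (Matrix.of fun i j : Fin 2 => if i.val + j.val + 1 = 2 then (1 : L) else 0) w).prod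
            (cmLocalIntegralLevel L 1 (Matrix.of fun i j : Fin 1 => if i.val + j.val + 1 = 1 then (1 : L) else 0) w) :
          Subgroup (HLoc L w)) : Set (HLoc L w)) = 1 →
      νQw (cmLocalIntegralLevel L 3 (qsForm L) w : Set (Gqs L w)) = 1 →
      IsLocalUnitTransfer L (qsForm L) w ((finExplicitCollection L (qsForm L) μ (finExplicitDelta_conj_left_all L (qsForm L) μ)
        (finExplicitDelta_conj_right_all L (qsForm L) μ)) w) mHw mQw)
    (hμω : ∀ x : Literature.NumberTheory.GaloisRepresentations.ideleGroup ↥(maximalRealSubfield L),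
      μ (AdeleRing.ideleBaseChange (↥(maximalRealSubfield L)) L x) = quadraticHeckeCharCM L x)
    (hmH : mHw.IsCanonical (IsLocalGRegular L w) νHw)
    (hmQ : mQw.IsCanonical (fun γ => IsRegularElt (γ.val : GL (Fin 3) (UnitaryGroup.LocalRing L w))) νQw)
    (hU : ∀ W : PlacesOver L w, Algebra.IsUnramifiedAt (𝓞 ↥(maximalRealSubfield L)) W.1.asIdeal ∧ μ.IsUnramifiedAt W.1)
    (hKG : KG = cmLocalIntegralLevel L 3 (qsForm L) w)
    (hKH : KHw = (cmLocalIntegralLevel L 2 (Matrix.of fun i j : Fin 2 => if i.val + j.val + 1 = 2 then (1 : L) else 0) w).prod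
      (cmLocalIntegralLevel L 1 (Matrix.of fun i j : Fin 1 => if i.val + j.val + 1 = 1 then (1 : L) else 0) w))
    (hvolH : νHw (KHw : Set (HLoc L w)) = 1) (hvolG : νQw (KG : Set (Gqs L w)) = 1)
    (χ₂ : ↥(torusU (conjLocal L (IsCMField.complexConj L) w) (cmLocalForm L 2 w)) →* ℂˣ) (χ₁ : H1Loc L w →* ℂˣ)
    (hχ₁ : IsOpen ((χ₁.ker : Subgroup (H1Loc L w)) : Set (H1Loc L w)))
    {Vw : Type} [AddCommGroup Vw] [Module ℂ Vw] (ρw : Representation ℂ (HLoc L w) Vw)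
    (hρ : Nonempty (ρw.Equiv (cmPrincipalSeriesH L w χ₂ χ₁))) (hline : Module.finrank ℂ ↥(ρw.fixedPoints KHw) = 1) :
    ∃ πw : IrrClass (Gqs L w), πw.IsAdmissible ∧ UnramCharIdentityLetter L μ w KG KHw νQw νHw mHw mQw πw ρw := by
  obtain ⟨hKc, hKo⟩ : IsCompact (KG : Set (Gqs L w)) ∧ IsOpen (KG : Set (Gqs L w)) := by
    rw [hKG]; exact UnitaryGroup.isCompact_isOpen_cmLocalIntegralLevel L 3 (qsForm L) w
  exact exists_unramCharIdentityLetter_of_abstractLetter L μ w KG KHw νQw νHw mHw mQw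
    (psLocalCharTransferAbstractLetter_of_letters L μ w KG KHw νQw νHw mHw mQw hA hB' hFL hμω hmH hmQ) hKo hKc hU hKG hKH hvolH hvolG χ₂ χ₁ hχ₁ ρw hρ hline

/-- **(M3) ASSEMBLY FOR A GIVEN CLASS — from the letters**: if moreover the GIVEN admissible class `π_w` has the same Hecke eigencharacter as every admissible
(M3)-partner of `ρ_w` (the e.v.p. pin `hevp`), then `UnramCharIdentityLetter … π_w ρ_w` — ★ bridge′ `unramCharIdentityLetter_of_abstractLetter` over (J); `K` compact
open and `νQw.real K = 1 ≠ 0` from the level pin and the unit volume. [cite: Rogawski1990, §13.8 p. 219 L3; §13.6 p. 209] [cite: CartierCorvallis1979, §IV.1 Cor. 4.1–4.2] -/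
theorem unramCharIdentityLetter_of_letters
    (hA : SplitHVanDijkLetter L μ w νHw mHw mQw) (hB' : SplitAbstractTransferLetter L μ w νQw νHw)
    (hFL : (∀ W : PlacesOver L w, Algebra.IsUnramifiedAt (𝓞 ↥(maximalRealSubfield L)) W.1.asIdeal ∧ μ.IsUnramifiedAt W.1) →
      (∀ W : PlacesOver L w, IsCMField.complexConj L • W.1 = W.1) →
      νHw (((cmLocalIntegralLevel L 2 (Matrix.of fun i j : Fin 2 => if i.val + j.val + 1 = 2 then (1 : L) else 0) w).prod
            (cmLocalIntegralLevel L 1 (Matrix.of fun i j : Fin 1 => if i.val + j.val + 1 = 1 then (1 : L) else 0) w) :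
          Subgroup (HLoc L w)) : Set (HLoc L w)) = 1 →
      νQw (cmLocalIntegralLevel L 3 (qsForm L) w : Set (Gqs L w)) = 1 →
      IsLocalUnitTransfer L (qsForm L) w ((finExplicitCollection L (qsForm L) μ (finExplicitDelta_conj_left_all L (qsForm L) μ)
        (finExplicitDelta_conj_right_all L (qsForm L) μ)) w) mHw mQw)
    (hμω : ∀ x : Literature.NumberTheory.GaloisRepresentations.ideleGroup ↥(maximalRealSubfield L),
      μ (AdeleRing.ideleBaseChange (↥(maximalRealSubfield L)) L x) = quadraticHeckeCharCM L x)
    (hmH : mHw.IsCanonical (IsLocalGRegular L w) νHw)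
    (hmQ : mQw.IsCanonical (fun γ => IsRegularElt (γ.val : GL (Fin 3) (UnitaryGroup.LocalRing L w))) νQw)
    (hU : ∀ W : PlacesOver L w, Algebra.IsUnramifiedAt (𝓞 ↥(maximalRealSubfield L)) W.1.asIdeal ∧ μ.IsUnramifiedAt W.1)
    (hKG : KG = cmLocalIntegralLevel L 3 (qsForm L) w)
    (hKH : KHw = (cmLocalIntegralLevel L 2 (Matrix.of fun i j : Fin 2 => if i.val + j.val + 1 = 2 then (1 : L) else 0) w).prod
      (cmLocalIntegralLevel L 1 (Matrix.of fun i j : Fin 1 => if i.val + j.val + 1 = 1 then (1 : L) else 0) w))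
    (hvolH : νHw (KHw : Set (HLoc L w)) = 1) (hvolG : νQw (KG : Set (Gqs L w)) = 1)
    (χ₂ : ↥(torusU (conjLocal L (IsCMField.complexConj L) w) (cmLocalForm L 2 w)) →* ℂˣ) (χ₁ : H1Loc L w →* ℂˣ)
    (hχ₁ : IsOpen ((χ₁.ker : Subgroup (H1Loc L w)) : Set (H1Loc L w)))
    {Vw : Type} [AddCommGroup Vw] [Module ℂ Vw] (ρw : Representation ℂ (HLoc L w) Vw)
    (hρ : Nonempty (ρw.Equiv (cmPrincipalSeriesH L w χ₂ χ₁))) (hline : Module.finrank ℂ ↥(ρw.fixedPoints KHw) = 1)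
    (πw : IrrClass (Gqs L w)) (hadm : πw.IsAdmissible)
    (hevp : ∀ π' : IrrClass (Gqs L w), π'.IsAdmissible → UnramCharIdentityLetter L μ w KG KHw νQw νHw mHw mQw π' ρw →
      ∃ t : (Gqs L w → ℂ) → ℂ, πw.IsSphericalWith KG νQw t ∧ π'.IsSphericalWith KG νQw t) :
    UnramCharIdentityLetter L μ w KG KHw νQw νHw mHw mQw πw ρw := by
  obtain ⟨hKc, hKo⟩ : IsCompact (KG : Set (Gqs L w)) ∧ IsOpen (KG : Set (Gqs L w)) := by
    rw [hKG]; exact UnitaryGroup.isCompact_isOpen_cmLocalIntegralLevel L 3 (qsForm L) w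
  have hμK : νQw.real (KG : Set (Gqs L w)) ≠ 0 := by
    rw [measureReal_def, hvolG, ENNReal.toReal_one]; exact one_ne_zero
  exact unramCharIdentityLetter_of_abstractLetter L μ w KG KHw νQw νHw mHw mQw
    (psLocalCharTransferAbstractLetter_of_letters L μ w KG KHw νQw νHw mHw mQw hA hB' hFL hμω hmH hmQ) hKo hKc hμK hU hKG hKH hvolH hvolG χ₂ χ₁ hχ₁ ρw hρ
    hline πw hadm hevp

end Junction

end Summit.HodgeConjecture.HodgeConjecture.R90.S10

end
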